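import Mathlib
import Summits.Ventures.PercRepro2.TypedLocusBridge3

/-!
# The block-transfer rule for typed counts, with the one-sided `o` (blind cell PercRepro2, mine-2 g37,
2026-08-28; `proofs/MINE2-FIBRE.md` §2b, row M2-77)

On a fibre in which `a₃` is attached to the root `r` by the forced-open edges and no copy with `Q`
joins `o` to the other root, `F = σ_o − σ₃ 1_{o∈U}` vanishes in every copy with `Q` (`o` is on
`a₃`'s side or unattached), so the piece vanishes pointwise (`pinnedCount_covW_eq_zero_of_oneSided`).
`typedCount_eq_zero_of_blocks'''` adds this alternative (`OneSidedO`) to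
`typedCount_eq_zero_of_blocks''`; its hypothesis is the census flag LEAN4.

Own code; standard axioms.
-/

namespace Summit.Ventures.PercRepro2

open UnionCluster

namespace CovForm

namespace LocusBridge

open OneTyped TypedA3 BlockTransfer

section OneSided

open Classical

variable {V : Type*} {E : Type*} [Fintype E] [DecidableEq E] {R : Type*} [Field R]
  [LinearOrder R] [IsStrictOrderedRing R]
variable (ends : E → Sym2 V) (o a₁ a₂ a₃ b : V)

/-- The one-sided `o` on a spectator's fibre: `a₃` attached to a root `r` by the forced-open
configuration, and no copy of the fibre with `Q` joins `o` to the other root. -/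
def OneSidedO (F : Finset E) (z : Config E) (τ : E → ℕ) (x : Config E) : Prop :=
  (Conn ends (specPin F z τ x) a₃ a₁ ∧ ∀ y : Config E, (∀ e, e ∉ specFree F τ x → y e = specPin F z τ x e) →
      ¬ Conn ends y a₂ a₁ → ¬ Conn ends y a₂ o) ∨
  (Conn ends (specPin F z τ x) a₃ a₂ ∧ ∀ y : Config E, (∀ e, e ∉ specFree F τ x → y e = specPin F z τ x e) →
      ¬ Conn ends y a₂ a₁ → ¬ Conn ends y a₁ o)

omit [Fintype E] [DecidableEq E] [LinearOrder R] [IsStrictOrderedRing R] in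
/-- In a copy with `Q`, `a₃` on the side of `a₁` and `o` not on the side of `a₂`, `F = 0`. -/
lemma Fc_eq_zero_left (y : Config E) (hQ : ¬ Conn ends y a₂ a₁) (h3 : Conn ends y a₃ a₁)
    (ho : ¬ Conn ends y a₂ o) : (Fc ends o a₁ a₂ a₃ y : R) = 0 := by
  unfold Fc sigma inU iL iH
  simp only [Set.indicator_apply, mem_connEvent, Pi.one_apply]
  have h31 : Conn ends y a₁ a₃ := conn_symm h3
  have h32 : ¬ Conn ends y a₂ a₃ := fun h => hQ (conn_trans h (conn_symm h31))
  rw [if_pos h31, if_neg h32, if_neg ho]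
  split_ifs <;> ring

omit [Fintype E] [DecidableEq E] [LinearOrder R] [IsStrictOrderedRing R] in
/-- In a copy with `Q`, `a₃` on the side of `a₂` and `o` not on the side of `a₁`, `F = 0`. -/
lemma Fc_eq_zero_right (y : Config E) (hQ : ¬ Conn ends y a₂ a₁) (h3 : Conn ends y a₃ a₂)
    (ho : ¬ Conn ends y a₁ o) : (Fc ends o a₁ a₂ a₃ y : R) = 0 := by
  unfold Fc sigma inU iL iH
  simp only [Set.indicator_apply, mem_connEvent, Pi.one_apply]
  have h32 : Conn ends y a₂ a₃ := conn_symm h3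
  have h31 : ¬ Conn ends y a₁ a₃ := fun h => hQ (conn_trans h32 (conn_symm h))
  rw [if_neg h31, if_pos h32, if_neg ho]
  split_ifs <;> ring

omit [LinearOrder R] [IsStrictOrderedRing R] in
/-- With a one-sided `o`, the covariance of `F` against `σ_b` has complementary-pair count `0`. -/
lemma pinnedCount_covW_eq_zero_of_oneSided (F : Finset E) (z : Config E) (τ : E → ℕ)
    (x : Config E) (h : OneSidedO ends o a₁ a₂ a₃ F z τ x) :
    pinnedCount (specFree F τ x) (specPin F z τ x)
      (covW ends a₁ a₂ (Fc ends o a₁ a₂ a₃) (sigma ends a₁ a₂ b) : Config E → Config E → R) = 0 := by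
  unfold pinnedCount
  refine Finset.sum_eq_zero fun y _ => ?_
  split_ifs with hy
  · obtain ⟨hle1, hle2⟩ := specPin_le_pair F z τ x y hy
    have hw : ∀ e, e ∉ specFree F τ x → flipOn (specFree F τ x) y e = specPin F z τ x e :=
      fun e he => by rw [flipOn_of_notMem _ _ he]; exact hy e he
    unfold covW
    by_cases hQy : Conn ends y a₂ a₁
    · rw [iQ_eq_ite', if_pos hQy]; ring
    by_cases hQw : Conn ends (flipOn (specFree F τ x) y) a₂ a₁
    · rw [iQ_eq_ite' (flipOn (specFree F τ x) y), if_pos hQw]; ring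
    rcases h with ⟨h3, ho⟩ | ⟨h3, ho⟩
    · rw [Fc_eq_zero_left ends o a₁ a₂ a₃ y hQy (conn_mono hle1 h3) (ho y hy hQy),
        Fc_eq_zero_left ends o a₁ a₂ a₃ _ hQw (conn_mono hle2 h3) (ho _ hw hQw)]
      ring
    · rw [Fc_eq_zero_right ends o a₁ a₂ a₃ y hQy (conn_mono hle1 h3) (ho y hy hQy),
        Fc_eq_zero_right ends o a₁ a₂ a₃ _ hQw (conn_mono hle2 h3) (ho _ hw hQw)]
      ring
  · rfl

/-- **The block-transfer rule for typed counts, with the one-sided `o`.** -/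
theorem typedCount_eq_zero_of_blocks''' (F : Finset E) (z : Config E) (τ : E → ℕ)
    (hτ : ∀ e ∈ F, τ e = 1 ∨ τ e = 2)
    (H3 : ∀ x : Config E, (∀ e, e ∉ F → x e = z e) → ¬ Conn ends x a₂ a₁ → ¬ Conn ends x a₁ a₃ →
      ¬ Conn ends x a₂ a₃ → (Conn ends (specPin F z τ x) a₃ a₁ ∨ Conn ends (specPin F z τ x) a₃ a₂))
    (HW : ∀ x : Config E, (∀ e, e ∉ F → x e = z e) → ¬ Conn ends x a₂ a₁ → ¬ Conn ends x a₁ a₃ →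
      ¬ Conn ends x a₂ a₃ →
      (∃ W : Finset V, BlockData ends a₁ a₂ W (specFree F τ x) (specPin F z τ x) ∧
        ((b ∈ W ∧ o ∉ W ∧ a₃ ∉ W) ∨ (o ∈ W ∧ a₃ ∈ W ∧ b ∉ W))) ∨
      (Conn ends (specPin F z τ x) b a₁ ∨ Conn ends (specPin F z τ x) b a₂) ∨
      (Conn ends (specPin F z τ x) o a₁ ∨ Conn ends (specPin F z τ x) o a₂) ∨
      (∃ e ∈ specFree F τ x, ∃ u v, ends e = s(u, v) ∧ Conn ends (specPin F z τ x) u a₁ ∧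
        Conn ends (specPin F z τ x) v a₂) ∨
      OneSidedO ends o a₁ a₂ a₃ F z τ x) :
    typedCount F z τ (K3 ends o a₁ a₂ a₃ b : Config E → Config E → Config E → R) = 0 := by
  have h2 := two_mul_typedCount_eq_pieces (R := R) ends o a₁ a₂ a₃ b F z τ hτ
  rw [typedCount_eq_sum_spec F z τ hτ (Dc ends o a₁ a₂ a₃ b : Config E → Config E → Config E → R)]
    at h2
  have hzero : ∀ x : Config E, (∀ e, e ∉ F → x e = z e) →
      pinnedCount (specFree F τ x) (specPin F z τ x)
        (Dc ends o a₁ a₂ a₃ b x : Config E → Config E → R) = 0 := by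
    intro x hx
    have hcongr : pinnedCount (specFree F τ x) (specPin F z τ x)
        (Dc ends o a₁ a₂ a₃ b x : Config E → Config E → R) =
        pinnedCount (specFree F τ x) (specPin F z τ x) (fun y w =>
          ((qB (st ends o a₁ a₂ a₃ b x) * pdB (st ends o a₁ a₂ a₃ b x) : ℤ) : R) *
            covW ends a₁ a₂ (Fc ends o a₁ a₂ a₃) (sigma ends a₁ a₂ b) y w) := by
      unfold pinnedCount
      refine Finset.sum_congr rfl fun y _ => ?_
      split_ifs with hy
      · exact Dc_eq_on_fibre ends o a₁ a₂ a₃ b F z τ hτ H3 x hx y hy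
      · rfl
    rw [hcongr, pinnedCount_const_mul]
    by_cases hpd : pdB (st ends o a₁ a₂ a₃ b x) = 0
    · rw [hpd]; simp
    · obtain ⟨hQx, h13, h23⟩ := pd_of_pdB_ne_zero ends o a₁ a₂ a₃ b x hpd
      have hzero' : pinnedCount (specFree F τ x) (specPin F z τ x)
          (covW ends a₁ a₂ (Fc ends o a₁ a₂ a₃) (sigma ends a₁ a₂ b) : Config E → Config E → R) = 0 := by
        rcases HW x hx hQx h13 h23 with ⟨W, hd, hW⟩ | hb | ho | ⟨e, he, u, v, hends, hu, hv⟩ | hone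
        · rcases hW with ⟨hb, ho, h3⟩ | ⟨ho, h3, hb⟩
          · have h0 := pinnedCount_blockTransfer_b (R := R) hd ho h3 hb
            rw [← h0]
            exact pinnedCount_congr _ _ _ _ (fun y w => rfl)
          · have h0 := pinnedCount_blockTransfer_o (R := R) hd ho h3 hb
            rw [← h0]
            exact pinnedCount_congr _ _ _ _ (fun y w => by unfold covW Fc; ring)
        · rcases hb with hb | hb
          · exact pinnedCount_covW_eq_zero_of_b_attached ends o a₁ a₂ a₃ b F z τ x (Or.inl rfl) hb
          · exact pinnedCount_covW_eq_zero_of_b_attached ends o a₁ a₂ a₃ b F z τ x (Or.inr rfl) hb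
        · rcases H3 x hx hQx h13 h23 with h3 | h3 <;> rcases ho with ho | ho
          · exact pinnedCount_covW_eq_zero_of_o_attached ends o a₁ a₂ a₃ b F z τ x (Or.inl rfl)
              (Or.inl rfl) ho h3
          · exact pinnedCount_covW_eq_zero_of_o_attached ends o a₁ a₂ a₃ b F z τ x (Or.inr rfl)
              (Or.inl rfl) ho h3
          · exact pinnedCount_covW_eq_zero_of_o_attached ends o a₁ a₂ a₃ b F z τ x (Or.inl rfl)
              (Or.inr rfl) ho h3
          · exact pinnedCount_covW_eq_zero_of_o_attached ends o a₁ a₂ a₃ b F z τ x (Or.inr rfl)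
              (Or.inr rfl) ho h3
        · exact pinnedCount_covW_eq_zero_of_killed ends o a₁ a₂ a₃ b F z τ x he hends hu hv
        · exact pinnedCount_covW_eq_zero_of_oneSided ends o a₁ a₂ a₃ b F z τ x hone
      rw [hzero']; ring
  have hsum : (∑ x : Config E, if (∀ e, e ∉ F → x e = z e) then
      pinnedCount (specFree F τ x) (specPin F z τ x)
        (Dc ends o a₁ a₂ a₃ b x : Config E → Config E → R) else 0) = (0 : R) := by
    refine Finset.sum_eq_zero fun x _ => ?_
    split_ifs with hx
    · exact hzero x hx
    · rfl
  rw [hsum] at h2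
  have h2' : (2 : R) ≠ 0 := by norm_num
  exact (mul_eq_zero.mp h2).resolve_left h2'

end OneSided

end LocusBridge

end CovForm

end Summit.Ventures.PercRepro2
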